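import Summits.QuantumFields.YangMills.Theorems.UnitScaleTiltFluctuationComparisonRegPrIntLOneSupplierDisplayV4
import Summits.QuantumFields.YangMills.Theorems.UnitScaleTiltMinimiserStabilityRegPrAttainmentOfExist
import Summits.QuantumFields.YangMills.Theorems.UnitScaleTiltMinimiserStabilityRegPrProp8Iter
import Summits.QuantumFields.YangMills.Theorems.UnitScaleTiltFluctuationComparisonRegPrIntLStub1
import Summits.QuantumFields.YangMills.Theorems.UnitScaleTiltMinimiserStabilityRegPrAttainmentOfExistence
import Summits.QuantumFields.YangMills.Theorems.UnitScaleTiltFluctuationComparisonRegPrIntLT8OfHalvingExist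
import HarnessLib

/-!
# `UnitScaleTiltFluctuationComparisonRegPrIntLT8OfHalvingExistV4` — THE v4 TWIN (★★OWNER RULING g26-№14 (F-2b); P22b, width seat ym-ust-20520-w2 g4; skeleton v5kD `Lines/birth_v5kD.lean` commit 435ca54d297c) of the three doors of `…IntLT8OfHalvingExist` (★w3-20520 g2 p592464; §1–§2 record-free, imported): STUB T8 AND THE DECIDING CRUX `FluctuationComparisonRegPrIntL` FROM **TWO** OF 19200's LEAVES:
# THE ONE-STEP HALVING `stub_halvingStep` AND THE EXISTENCE CLAUSE `stub_existenceMinimalOrbit` — NO [B8] THM 2, NO PROPS 5–6, NO (141)–(142)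
# (crux stmt-QuantumFields-20520, skeleton v5kC `Cruxes/FluctuationComparisonRegPrIntL/Lines/birth_v5kC.lean` 3aa24e4fa8fcb956; width seat ym-ust-20520-w3 g2, letter «w3 = T8»)

The v5kC stub T8 `stub_thm1In8GlobalMin` (`∀ L, Odd L → 1 < L → ∃ a₀ a₁ B₃ > 0, Thm1GlobalMinAt L a₀ a₁ B₃ ∧ MinimisersIn8At L a₀ a₁ B₃`) is [Balaban1985Variational]
Thm 1 in the tree's global reading together with its (8)-clause for EVERY minimiser.  ★ym-ust-19935-r1 g4/g5 reduced it BY NAME to the leaves of crux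
`MinimiserStabilityRegPr`'s skeleton v7/v8 (`thm1In8GlobalMin_of_v7Leaves`, `…_of_v8Leaves`, `…_of_v8Leaves4`: halving → P-V3-A → P-V3-C → (P-V3-D) → P-V3-E → T8), i.e.
through print's internal route to Prop. 7 ([Balaban1985RegularSpaces] Thm 2 chart = WANTED W-19200-T2, Props 5–6, (18), (141)–(142)).

ym-ust-19200-w2 g0's LOCATED FINDING #4 (2026-08-28T00:57Z, kernel-checked in `…MinimiserStabilityRegPrAttainmentOfExist`, p590733) and OWNER RULING g24-№3′ (v9 stub set
{`stub_halvingStep`, `stub_PV3A`, `stub_PV3Cuniq`, `stub_existenceMinimalOrbit`}, pen `plan-g24/birth_v9.lean` 33b3e71f6fbd2e5d) make the SHORT route available by name: the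
variational data 19200's composition consumes — attainment over (6) (`MinSixAttainedAt`) and the (8)-clause (`MinimisersIn8At`) — follow from Prop. 7's EXISTENCE clause
from a background (row EX = `BirthV9.stub_existenceMinimalOrbit` = route-R's `stub_existenceMinimalOrbit`, text shared verbatim) and the halving iteration ALONE
(`AttainmentOfExist.minSixAttainedAt_of_exist_prop8`, `Prop8Iter`, `T3Thm1Carrier.minimisersIn8At_of_prop8`); the uniqueness clause (i) of Prop. 7 — hence rows A and C-uniq —
is never read.  T8 is exactly that pair of data (`InteriorExcision.thm1In8_of_attained_of_in8`).  So:

* `existMinimalFam_of_existenceMinimalOrbit` — the owner's EX text at `(L, B₃)` (torus-family form `∃ U ∈ regFibrePr …, IsMinOn …`) IS ym-ust-19200-w2's carrier form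
  (`(famX L i).OnMinimalOrbit (O₁L³B₃ε₁) V U`, hypothesis `H7` of `minSixAttainedAt_of_exist_prop8`) — anonymous-constructor bookkeeping;
* `prop8Printed_of_halving_L` — per block size: the halving text at `L` ⟹ `∃ B₃ > 4, Prop8Printed B₃ (famX L)` (`Prop8Iter.prop8_of_halvingLiteral`, one `L`);
* **`thm1In8GlobalMinAt_of_halving_exist_L`** — per block size `L > 1`: ⟨halving at `L`⟩ → ⟨EX at `L`⟩ → `∃ a₀ a₁ B₃ > 0, Thm1GlobalMinAt L a₀ a₁ B₃ ∧ MinimisersIn8At L a₀ a₁ B₃`;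
* (the ∀-`L` form ⟨`BirthV9.stub_halvingStep` VERBATIM⟩ → ⟨`BirthV9.stub_existenceMinimalOrbit` VERBATIM⟩ → ⟨T8 TEXT VERBATIM⟩ is ym-ust-20520-w4 g0's
  `AttainmentOfExistence.thm1In8GlobalMin_of_halvingStep_of_existence`, landed minutes earlier with its own native attainment chain — consumed here by name, not restated);
* **`regPrIntL_of_halving_exist_recChiV4_k1aLegRowsRChiV4_allL`** / **`…_k1aChartRowsKChi_allL`** / **`…_k1aLegRowsDisplayChi_allL`** — the deciding crux from {halving, EX},
  the χ-record 2′χ, and ONE block-size-uniform K1a predicate (T8 slot = w4's theorem) (leg rows `K1aLegRowsRChiV4` / chart rows `K1aChartRowsKChiV4` / ym-ust-20520-w1's per-run display obligation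
  `K1aLegRowsDisplayChiV4`) at every odd `L > 1`, through ★r1 g3's record-free engine `regPrIntL_of_v4ChiStubs` with STUB 1 by `IntLStub1.stub_oneStepSmallLift` (p591578).

CONSEQUENCE FOR THE DEPMAP (count-neutral, no binder touched): 20520's variational input is {`stub_halvingStep`, `stub_existenceMinimalOrbit`} of 19200 — it does NOT wait on
W-19200-T2 / `stub_PV3A` / `stub_PV3Cuniq`, whatever v9's registered stub set.  HONEST FRAMING: composition of landed theorems over hypothesis texts; the hypotheses ARE the
analytic content ([Balaban1985Variational] Sect. F halving; Prop. 7's existence clause; the χ-record; the K1a rows) and none is asserted here; registry untouched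
(`--supports stmt-QuantumFields-20520`).  Cell `ym3-torus` (HUMAN RULING D-0037): YM₃ on T³ is ladder rung R3, NOT the Clay problem, not d = 4, not a mass gap.

References: T. Bałaban, CMP 102 (1985) 277–309 [Balaban1985Variational] ((6)–(8) pp.278–279, Thm 1 (8) p.279, (14) p.280, Prop. 7 p.299, Sect. F p.300, Prop. 8 p.304);
CMP 102 (1985) 255–275 [Balaban1985UV3] ((41) p.266, (43)–(47) pp.266–267, (57) p.270); C. King, CMP 102 (1986) 649–677 [King1986] (Thm 3.4 (3.9) p.656, Prop. 3.6 (3.56) p.662);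
T. Bałaban, CMP 109 (1987) 249–301 [Balaban1987RG1] ((0.4) p.253).
-/

set_option autoImplicit false

noncomputable section

namespace Summit.QuantumFields.YangMills.Theorems.IntLT8OfHalvingExistV4

open Summit.QuantumFields.YangMills.Theorems.IntLT8OfHalvingExist

open Literature.MathematicalPhysics.QuantumFieldTheory.Balaban1983to89
open Literature.MathematicalPhysics.QuantumFieldTheory.Balaban1983to89.T3ContinuumYM3Torus
open Literature.MathematicalPhysics.QuantumFieldTheory.Balaban1983to89.T3UnitLawDensityEML (ℰp)
open Literature.MathematicalPhysics.QuantumFieldTheory.Balaban1983to89.T3SmallLiftHistory (OneStepSmallLift)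
open Literature.MathematicalPhysics.QuantumFieldTheory.Balaban1983to89.T3InteriorExcision
open Literature.MathematicalPhysics.QuantumFieldTheory.Balaban1983to89.T3PrintedRegularMinimiser
open Literature.MathematicalPhysics.QuantumFieldTheory.Balaban1983to89.T3PrintedMinimiserExistence
open Literature.MathematicalPhysics.QuantumFieldTheory.Balaban1983to89.T3ConstrainedMinimiser (fibre)
open Literature.MathematicalPhysics.QuantumFieldTheory.Balaban1983to89.T3LowerAlongMinimisersSplit (MinimisersIn8At)
open Literature.MathematicalPhysics.QuantumFieldTheory.Balaban1983to89.T3ExistSplit (MinSixAttainedAt)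
open Literature.MathematicalPhysics.QuantumFieldTheory.Balaban1983to89.T3Thm1Carrier (famX Idx minimisersIn8At_of_prop8)
open Literature.MathematicalPhysics.QuantumFieldTheory.Balaban1983to89.B11 (Prop8Printed)
open Summit.QuantumFields.Balaban3D.Carriers
open Summit.QuantumFields.Balaban3D.Proofs.Primitives
open Summit.QuantumFields.YangMills.Theorems.InteriorExcision
open Summit.QuantumFields.YangMills.Theorems.GlobalSlack (GlobalSupRateTSlack)
open Summit.QuantumFields.YangMills.Theorems.GlobalSlackOn (GlobalSupRateTSlackOn)
open Summit.QuantumFields.YangMills.Theorems.PrintChi (ChiGood)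
open Summit.QuantumFields.YangMills.Theorems.GlobalSlackCanonicalPolymers (K1aChartRowsKChiV4 globalTwoRunSlackFamChiV4_of_k1aChartRowsKChiV4)
open Summit.QuantumFields.YangMills.Theorems.GlobalSlackCanonicalOnChi (smallBlocksSlackOnChiAllChiV4_of_k1aChartRowsKChiV4_all)
open Summit.QuantumFields.YangMills.Theorems.GlobalSlackKernelLeg (K1aLegRowsRChiV4 K1aLegRowsDisplayChiV4 globalTwoRunSlackFamChiV4_of_k1aLegRowsRChiV4
  smallBlocksSlackOnChiAllChiV4_of_k1aLegRowsRChiV4_all)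

/-! ## §1 The two leaf texts at one block size, as predicates-free binders (no `def`): EX in torus-family form ⟹ EX in carrier form -/

-- (record-free `existMinimalFam_of_existenceMinimalOrbit`: imported from the v3 module, not restated)

-- (record-free `prop8Printed_of_halving_L`: imported from the v3 module, not restated)

/-! ## §2 T8 from the two leaves -/

-- (record-free `thm1In8GlobalMinAt_of_halving_exist_L`: imported from the v3 module, not restated)

/-! ## §3 The deciding crux from the two leaves, the χ-record, and ONE block-size-uniform K1a predicate -/

/-- **`FluctuationComparisonRegPrIntL` FROM {HALVING, EX}, THE χ-RECORD 2′χ AND ONE `L`-UNIFORM SUPPLIER IN PRINT'S LEG CURRENCY** (★r1 g5's `regPrIntL_of_v8Leaves_recChiV4_k1aLegRowsRChiV4_allL`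
with the T8 slot fed by ym-ust-20520-w4's `AttainmentOfExistence.thm1In8GlobalMin_of_halvingStep_of_existence`): STUB 1 by `IntLStub1.stub_oneStepSmallLift` (p591578), T8 by §2, 3⁗χ by `globalTwoRunSlackFamChiV4_of_k1aLegRowsRChiV4` (the
predicate at `L ≥ 7`), (i*)χ by `smallBlocksSlackOnChiAllChiV4_of_k1aLegRowsRChiV4_all` (the same predicate at `L < 7`), then ★r1 g3's engine `regPrIntL_of_v4ChiStubs`.
[cite: Balaban1985UV3, (41) p.266, (43)-(47) pp.266-267, (57) p.270; Balaban1985Variational, Thm 1 (8) p.279, Prop. 7 p.299, Prop. 8 p.304; King1986, Thm 3.4 (3.9) p.656, Prop. 3.6 (3.56) p.662; Balaban1987RG1, (0.4) p.253] -/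
theorem regPrIntL_of_halving_exist_recChiV4_k1aLegRowsRChiV4_allL
    (hH : ∀ (L : ℕ), 1 < L → ∃ B₃ : ℝ, 4 < B₃ ∧ ∃ a₅ : ℝ, 0 < a₅ ∧
      ∀ (i : Idx L) (ε₀ ε₁ : ℝ), 0 < ε₁ → ∀ (V : (famX L i).Bdry) (U : (famX L i).Cfg), (famX L i).Reg7 ε₁ V → (famX L i).InU ε₀ U →
        (famX L i).InB V U → (famX L i).IsCritical V U → ε₀ ≤ a₅ → (famX L i).InU (max (B₃ * ε₁) (ε₀ / 2)) U)
    (hEX : ∀ (L : ℕ), 1 < L → ∀ (B₃ : ℝ), 4 < B₃ → ∃ a₁' O₁ : ℝ, 0 < a₁' ∧ 1 ≤ O₁ ∧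
      ∀ (F : T3Family), F.L = L → ∀ (n K : ℕ) (hnK : n < K) (ε₁ : ℝ), 0 < ε₁ →
        ∀ V : GaugeField (F.P n) 0 (Matrix.specialUnitaryGroup (Fin 2) ℂ), PlaqSmall ε₁ V →
          ∀ U₀ : GaugeField (F.P K) 0 (Matrix.specialUnitaryGroup (Fin 2) ℂ), RegPr F n K ((L : ℝ) ^ 3 * B₃ * ε₁) U₀ → U₀ ∈ fibre F ℰp n K hnK.le V →
            ε₁ ≤ a₁' → ∃ U ∈ regFibrePr F n K hnK.le (O₁ * (L : ℝ) ^ 3 * B₃ * ε₁) V,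
              IsMinOn (fun W : GaugeField (F.P K) 0 (Matrix.specialUnitaryGroup (Fin 2) ℂ) => wilsonAction4 W)
                (regFibrePr F n K hnK.le (O₁ * (L : ℝ) ^ 3 * B₃ * ε₁) V) U)
    (h2 : ∀ L : ℕ, Odd L → 1 < L → Summit.QuantumFields.YangMills.Theorems.AlphaInputsT3ACv4RecChi L)
    (hK : ∀ (L : ℕ), Odd L → 1 < L → ∀ (𝔠 : AlphaConsts L (suGroupModel 2).N) (a₀ a₁ : ℝ), 0 < a₀ → 0 < a₁ → 𝔠.B₃ * a₁ ≤ a₀ →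
      ∃ a : ℝ, 0 < a ∧ a < 1 ∧ K1aLegRowsRChiV4 L 𝔠 a₀ a₁ a) :
    FluctuationComparisonRegPrIntL :=
  regPrIntL_of_v4ChiStubs IntLStub1.stub_oneStepSmallLift (AttainmentOfExistence.thm1In8GlobalMin_of_halvingStep_of_existence hH hEX) h2
    (globalTwoRunSlackFamChiV4_of_k1aLegRowsRChiV4 fun L hLo h7 𝔠 a₀ a₁ ha0 ha1 hw => hK L hLo (by omega) 𝔠 a₀ a₁ ha0 ha1 hw)
    (smallBlocksSlackOnChiAllChiV4_of_k1aLegRowsRChiV4_all fun L hLo hL1 _ 𝔠 a₀ a₁ ha0 ha1 hw => hK L hLo hL1 𝔠 a₀ a₁ ha0 ha1 hw)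

/-- **THE SAME IN CHART CURRENCY** (six chart rows at the χ-record's canonical polymerisation, `K1aChartRowsKChiV4`, at every odd `L > 1`): 3⁗χ by `globalTwoRunSlackFamChiV4_of_k1aChartRowsKChiV4`,
(i*)χ by `smallBlocksSlackOnChiAllChiV4_of_k1aChartRowsKChiV4_all`. [cite: Balaban1985UV3, (25) p.262, (43)-(47) pp.266-267; Balaban1985Variational, Thm 1 (8) p.279, Prop. 8 p.304; King1986, Thm 3.4 (3.9) p.656] -/
theorem regPrIntL_of_halving_exist_recChiV4_k1aChartRowsKChiV4_allL
    (hH : ∀ (L : ℕ), 1 < L → ∃ B₃ : ℝ, 4 < B₃ ∧ ∃ a₅ : ℝ, 0 < a₅ ∧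
      ∀ (i : Idx L) (ε₀ ε₁ : ℝ), 0 < ε₁ → ∀ (V : (famX L i).Bdry) (U : (famX L i).Cfg), (famX L i).Reg7 ε₁ V → (famX L i).InU ε₀ U →
        (famX L i).InB V U → (famX L i).IsCritical V U → ε₀ ≤ a₅ → (famX L i).InU (max (B₃ * ε₁) (ε₀ / 2)) U)
    (hEX : ∀ (L : ℕ), 1 < L → ∀ (B₃ : ℝ), 4 < B₃ → ∃ a₁' O₁ : ℝ, 0 < a₁' ∧ 1 ≤ O₁ ∧
      ∀ (F : T3Family), F.L = L → ∀ (n K : ℕ) (hnK : n < K) (ε₁ : ℝ), 0 < ε₁ →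
        ∀ V : GaugeField (F.P n) 0 (Matrix.specialUnitaryGroup (Fin 2) ℂ), PlaqSmall ε₁ V →
          ∀ U₀ : GaugeField (F.P K) 0 (Matrix.specialUnitaryGroup (Fin 2) ℂ), RegPr F n K ((L : ℝ) ^ 3 * B₃ * ε₁) U₀ → U₀ ∈ fibre F ℰp n K hnK.le V →
            ε₁ ≤ a₁' → ∃ U ∈ regFibrePr F n K hnK.le (O₁ * (L : ℝ) ^ 3 * B₃ * ε₁) V,
              IsMinOn (fun W : GaugeField (F.P K) 0 (Matrix.specialUnitaryGroup (Fin 2) ℂ) => wilsonAction4 W)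
                (regFibrePr F n K hnK.le (O₁ * (L : ℝ) ^ 3 * B₃ * ε₁) V) U)
    (h2 : ∀ L : ℕ, Odd L → 1 < L → Summit.QuantumFields.YangMills.Theorems.AlphaInputsT3ACv4RecChi L)
    (hK : ∀ (L : ℕ), Odd L → 1 < L → ∀ (𝔠 : AlphaConsts L (suGroupModel 2).N) (a₀ a₁ : ℝ), 0 < a₀ → 0 < a₁ → 𝔠.B₃ * a₁ ≤ a₀ →
      ∃ a : ℝ, 0 < a ∧ a < 1 ∧ K1aChartRowsKChiV4 L 𝔠 a₀ a₁ a) :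
    FluctuationComparisonRegPrIntL :=
  regPrIntL_of_v4ChiStubs IntLStub1.stub_oneStepSmallLift (AttainmentOfExistence.thm1In8GlobalMin_of_halvingStep_of_existence hH hEX) h2
    (globalTwoRunSlackFamChiV4_of_k1aChartRowsKChiV4 fun L hLo h7 𝔠 a₀ a₁ ha0 ha1 hw => hK L hLo (by omega) 𝔠 a₀ a₁ ha0 ha1 hw)
    (smallBlocksSlackOnChiAllChiV4_of_k1aChartRowsKChiV4_all fun L hLo hL1 _ 𝔠 a₀ a₁ ha0 ha1 hw => hK L hLo hL1 𝔠 a₀ a₁ ha0 ha1 hw)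

/-- **THE SAME FROM ym-ust-20520-w1's PER-RUN DISPLAY OBLIGATION** `K1aLegRowsDisplayChiV4` (seven per-run rows (R1) (R2′) (N) (M1) (F^Λ) (R4) (R5)) at every odd `L > 1`, through
★r1 g5's `k1aChartRowsKChiV4_of_displayChiV4`. [cite: Balaban1985UV3, (25) p.262, (43)-(45) pp.266-267, (57) p.270; Balaban1985Variational, Thm 1 (8) p.279, Prop. 8 p.304; King1986, Prop. 3.6 (3.56) p.662] -/
theorem regPrIntL_of_halving_exist_recChiV4_k1aLegRowsDisplayChiV4_allL
    (hH : ∀ (L : ℕ), 1 < L → ∃ B₃ : ℝ, 4 < B₃ ∧ ∃ a₅ : ℝ, 0 < a₅ ∧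
      ∀ (i : Idx L) (ε₀ ε₁ : ℝ), 0 < ε₁ → ∀ (V : (famX L i).Bdry) (U : (famX L i).Cfg), (famX L i).Reg7 ε₁ V → (famX L i).InU ε₀ U →
        (famX L i).InB V U → (famX L i).IsCritical V U → ε₀ ≤ a₅ → (famX L i).InU (max (B₃ * ε₁) (ε₀ / 2)) U)
    (hEX : ∀ (L : ℕ), 1 < L → ∀ (B₃ : ℝ), 4 < B₃ → ∃ a₁' O₁ : ℝ, 0 < a₁' ∧ 1 ≤ O₁ ∧
      ∀ (F : T3Family), F.L = L → ∀ (n K : ℕ) (hnK : n < K) (ε₁ : ℝ), 0 < ε₁ →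
        ∀ V : GaugeField (F.P n) 0 (Matrix.specialUnitaryGroup (Fin 2) ℂ), PlaqSmall ε₁ V →
          ∀ U₀ : GaugeField (F.P K) 0 (Matrix.specialUnitaryGroup (Fin 2) ℂ), RegPr F n K ((L : ℝ) ^ 3 * B₃ * ε₁) U₀ → U₀ ∈ fibre F ℰp n K hnK.le V →
            ε₁ ≤ a₁' → ∃ U ∈ regFibrePr F n K hnK.le (O₁ * (L : ℝ) ^ 3 * B₃ * ε₁) V,
              IsMinOn (fun W : GaugeField (F.P K) 0 (Matrix.specialUnitaryGroup (Fin 2) ℂ) => wilsonAction4 W)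
                (regFibrePr F n K hnK.le (O₁ * (L : ℝ) ^ 3 * B₃ * ε₁) V) U)
    (h2 : ∀ L : ℕ, Odd L → 1 < L → Summit.QuantumFields.YangMills.Theorems.AlphaInputsT3ACv4RecChi L)
    (hDisp : ∀ (L : ℕ), Odd L → 1 < L → ∀ (𝔠 : AlphaConsts L (suGroupModel 2).N) (a₀ a₁ : ℝ), 0 < a₀ → 0 < a₁ → 𝔠.B₃ * a₁ ≤ a₀ →
      ∃ a : ℝ, 0 < a ∧ a < 1 ∧ K1aLegRowsDisplayChiV4 L 𝔠 a₀ a₁ a) :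
    FluctuationComparisonRegPrIntL :=
  regPrIntL_of_halving_exist_recChiV4_k1aChartRowsKChiV4_allL hH hEX h2 fun L hLo hL1 𝔠 a₀ a₁ ha0 ha1 hw => by
    obtain ⟨a, ha, ha1', hc⟩ := hDisp L hLo hL1 𝔠 a₀ a₁ ha0 ha1 hw
    exact ⟨a, ha, ha1', k1aChartRowsKChiV4_of_displayChiV4 ha hc⟩

end Summit.QuantumFields.YangMills.Theorems.IntLT8OfHalvingExistV4

end
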